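import Summits.ResolutionOfSingularities.ResolutionOfSingularities.Theorems.JetCutLadder
import Mathlib
import HarnessLib

/-!
# JetCutMixed — decomp-res node «JetCut» (lens-2 g15 rev 5), file 1/2 of `JetCutMixed`

Content VERBATIM from the decomp-res lens-2 file `HOME/decomp-res-lens-2/g15/JetCut.lean` rev 5 (pin 9f53e5ca =
`parts/JetCut-rev5-9f53e5ca.lean`, 7 495 l;
HOME = run/shared/lean/pub/decomp-res; CRITIC-LEDGER rows 109 / 115 / 120 / 121 / 122 / 127 / 133 CLEARED; landing
order INBOX :231; the critic's
HYGIENE-landing.md h1–h11 applied — DOCSTRING-ONLY).  The lens's blocks RESTATED VERBATIM from lens-2 g12 / g13 /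
g14 (§R / §R13 / §R14) are DELETED:
they are the tree's `RelativeDeltaCut*` / `CurveLeafExit*` / `PinchCut*` modules (namespaces `RelativeDeltaCut`,
`CurveLeafExit`, `PinchCut`, opened;
the lens's `CurveLeafExitRestated.x` / `PinchCutRestated.x` are cited as `CurveLeafExit.x` / `PinchCut.x`, the three
pointwise engine edges of g12 as
`RelativeDeltaCut.x`).  Namespace `…Theorems.JetCut` (the lens's `Theses.JetCut` is gate-reserved), sub-namespaces
`Tame` / `Wide` / `Broad` / `Vast`
as in the lens; file split only (tree files ≤ 400 lines): sections, variables and every declaration exactly as in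
the lens, the long rev-0/1 prose
lives in HOME/decomp-res-lens-2/g15/NODE-g15.md §ARCHIVE-A (not in the tree).  Node files, in import order:
`JetCutJetKernels`, `JetCutPoint`, `JetCutClasses`, `JetCutKernels`, `JetCutTame`, `JetCutTameClasses`,
`JetCutTameKernels`, `JetCutLadder`, `JetCutWideClasses`, `JetCutWideKernels`, `JetCutMixed`, `JetCutBroadClasses`,
`JetCutBroadKernels`, `JetCutDegenerate`, `JetCutVastClasses`, `JetCutVastKernels`
(each possibly continued `…2`, `…3`), then the wiring `MaxContactCutJetCut*` (in the Theses cone).  All `--supports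
stmt-ResolutionOfSingularities-29273`
(`MaxContactCut.RungOne`); nothing closes 29273 — decided cells carry their engines as hypotheses, and exactly ONE
located-residual aside is booked on
the route for this column (`Vast.VastSpecialRung`, home `JetCutVastClasses`).

§M (rev 4): the MIXED LADDER (L′) — a DEPTH LAW with CLASS EXIT for tails led by a MIXED monomial `X₁^a W^b`: the
two-weight calculus `WtIdeal₂` and the mixed kernels (`mixed_chart_identity`, `mixed_weight_step`,
`mixed_sidechart_identity`, `mixed_depth`, PROVED), the FIBRE-MONOMIAL LEMMA **`not_purePower_of_fibre`** (`section
MixedField`, Mathlib-general, PROVED; HYGIENE h8), the mixed ring shape (HYGIENE h7), §M2 point level: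
`IsMixedLadderAt`, uniformly shaped curves, ENGINE (L′) `MixedLadderExit`, the BROAD leaf (B) = (W) ∪ (L′) with
`BroadExit`, the broad-special class and the pointwise kernels.

Part 1/2 carries: `mixed_weight_step`, `mixed_depth`, `mixed_depth_zero_eq`, `mixed_chart_identity`,
`mixed_sidechart_identity`, `not_purePower_of_fibre`, `WtIdeal₂`, `wtIdeal_eq_wtIdeal₂`, `MixedLadderShape`,
`mixedLadderShape_trinomial`, `monomial_mem_wtIdeal₂`, `IsMixedLadderAt`, `IsUniformMixedLadderCurve`,
`MixedLadderExit`, `IsMixedLadderCurvePt`, `IsBroadCurvePt`, `BroadExit`, `IsBroadSpecialPt`,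
`isBroadCurvePt_of_isWideCurvePt`, `isBroadCurvePt_of_isMixedLadderCurvePt`, `isBroadCurvePt_of_isJetTameCurvePt`.

(Sources: HunekeSwanson2006 Cor. 5.5.5; CossartJannsenSaito2020 Ch. 2, Thm. 3.6/3.7, Ch. 8; CossartPiltant2008 Prop.
4.2; CossartPiltant2019 Rem. 3.2; Hironaka1964 Ch. III; Hironaka1967; Hironaka1977; Moh1987; Giraud1975.)
-/

open CategoryTheory AlgebraicGeometry TopologicalSpace IsLocalRing
open Literature.AlgebraicGeometry.Resolution
open Summit.ResolutionOfSingularities.ResolutionOfSingularities.Theorems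
open Summit.ResolutionOfSingularities.ResolutionOfSingularities.Theorems.WeakOrderReduction
open Summit.ResolutionOfSingularities.ResolutionOfSingularities.Theorems.DeltaFaceCutClasses
open Summit.ResolutionOfSingularities.ResolutionOfSingularities.Theorems.RelativeDeltaCut
open Summit.ResolutionOfSingularities.ResolutionOfSingularities.Theorems.CurveLeafExit
open Summit.ResolutionOfSingularities.ResolutionOfSingularities.Theorems.PinchCut

namespace Summit.ResolutionOfSingularities.ResolutionOfSingularities.Theorems.JetCut

section MixedKernel

/-! ## §M  NEW (g15, rev 4): the MIXED LADDER (L′) — a DEPTH LAW with CLASS EXIT for tails led by a MIXED monomial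
`U^a W^b` (`1 ≤ a < n`): the two-parameter tails `u₁⁵ + u₂⁵` of the bed (critic row 121 window), and the BROAD cut
(B) = wide ∪ mixed-ladder.

THE CLASS (closed point `y'` of the top curve `C`, germ dimension 4, `I` PRINCIPAL at `y'`): regular parameters
`(z, U, W; v)`, `C = V(z, U, W)`, `I_{y'} = (f)` with `f = zⁿ + β·Uⁿ + ε·U^a W^b + h`, `1 ≤ a < n`, `a + b ≥ n + 1`,
`ε` a unit, `h ∈ WtIdeal₂ c b (n−a) (nb+1)` — the ideal of the monomials `z^e U^a′ W^b′` of TWO-WEIGHT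
`(e + a′)·b + b′·(n − a) ≥ nb + 1` (weights `b, b, n−a` — and weight `0` on the coefficient ring: `WtIdeal₂ c wU wW
N` is an ideal of `𝒪_y`, so
`c`-free coefficients (units, `β`, `v`-multiples) of admissible monomials are admissible — this is what makes the
no-cancellation step of the stop stage true (a cancelling term would have to be an admissible MONOMIAL of the same
exponent, and there is none; HYGIENE h7); the mixed monomial itself has weight `nb`; rev 3's
`WtIdeal c n k N = WtIdeal₂ c k n N` definitionally) — and the cone coefficient `β` a transversal parameter or a unit
with `SideClean` (verbatim rev 3).  Bed: `z² + v(u₁+u₂)² + u₁⁵ + u₂⁵` in characteristic 2: `U = u₁ + u₂`, `W = u₁`,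
`u₁⁵ + u₂⁵ = U⁵ + U⁴W + UW⁴`, so `a = 1`, `b = 4`, `ε = 1`, `h = U⁵ + U⁴W` (weights `20, 17 ≥ 9`), `β = v`.

THE LAW (paper; EXACT-ON-PAPER with the bookkeeping and the exit lemma PROVED in kernel).  `W`-chart of the blow-up of
`C`: `f₁ = X₀ⁿ + βX₁ⁿ + ε·X₁^a W^{a+b−n} + h₁` (`mixed_chart_identity`; `h₁ ∈ WtIdeal₂ (…) (a+b−n) (n−a) (n(a+b−n)+1)`
by `mixed_weight_step` — the two-weight ideal reproduces EXACTLY, and every `h`-monomial has degree `≥ n+1`, so it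
stays in the exceptional ideal of every chart): the SHAPE REPRODUCES with `b ↦ b − (n − a)`.  PERFORMED stages
(`a + bᵢ ≥ n + 1`, `mixed_depth` (i)): the near locus over `C` is the section point of each fibre — over the core point
`(0, t ≠ 0)` has the linear part `tⁿ·dβ` (also at non-rational fibre points: `X₁` a unit there), `X₀ = c ≠ 0` gives
the value `cⁿ`, the `U`-chart carries `dβ`, the `z`-chart is `1 + βU′ⁿ + X₀·(…)` (`mixed_sidechart_identity`: the mixed
term carries `X₀^{a+bᵢ−n}`, exponent `≥ 1` at a performed stage) — a unit over the core point and of order `≤ 1` over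
unit-`β` points by `SideClean` (one fibre variable suffices: `gr`-injectivity of the flat extension by the second);
the section curve `Cᵢ ≅ C` (= the order-`n` locus `N₁` of the controlled transform over `C`, an intrinsic closed
subscheme — which is why the
local W-chart origins over the points of `C` glue to ONE regular curve `Cᵢ ≅ C`; HYGIENE h5) is regular and inside
the top locus of the principal transform (`f ∈ (X₀, X₁, W)ⁿ` by
the degree bound): weakly admissible (no snc clause in `WeakAdmissible`).  After `i₀ = (b − 1)/(n − a)` blow-ups
(`mixed_depth` (ii)–(iii): `1 ≤ b_{i₀}`, `a + b_{i₀} ≤ n`) the STOP stage: if `a + b_{i₀} < n` the mixed monomial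
(unit coefficient, weight `n·b_{i₀}`, strictly below every `h`-monomial, distinct from `X₀ⁿ`, `X₁ⁿ`) gives order
`a + b_{i₀} < n` at the section point; if `a + b_{i₀} = n` the initial form is
`N = X̄₀ⁿ [+ β̄X̄₁ⁿ] + ε̄·X̄₁^a W̄^{b_{i₀}} + Q̄` with `Q̄` of weight `≥ n·b_{i₀} + 1` — so `Q̄` contains neither
`X̄₁^aW̄^{b_{i₀}}` nor `W̄ⁿ` (weight `n(n−a) = n·b_{i₀}`): `N` INVOLVES `W̄` and VANISHES at the `W̄`-coordinate point,
hence `N ≠ c·ℓⁿ` for every scalar `c` and linear form `ℓ` — **`not_purePower_of_fibre`** (KERNEL) — i.e. `τ ≥ 2`: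
the last near point is of CLASS ≥ 2, which is the port's second exit condition (`PackageExitsOver`: order `< n` OR
`τ ≥ 2` at every order-`n` point over `S`).  The same computation at the generic point of the last section curve
(local ring of dimension 3 over `k(η)`, `β` a unit there) gives `τ ≥ 2` there too — NO generic-point theorem is used
(contrast (T)); other points over `C` have order `≤ 1` or are off `V(f)` as at performed stages; non-closed fibre
points by semicontinuity of order.  Hence ENGINE (L′) `MixedLadderExit` on paper for every regular `Y`, residue
field, characteristic: DECIDED-MOD-PORT (port L + HS 5.5.5 chart regularity + semicontinuity of order, as (J)/(T)/(L)).
Census (T-tame :824, T-jet B2): the `u₁⁵ + u₂⁵` controls show near points of `τ = 1` down to depth 3 and then ONE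
near point `X₀² + u_j·w` of `τ = 3` — the law's prediction `(4 − 1)/(2 − 1) = 3`, stop form `X̄₀² + X̄₁W̄`.
(L′) is not a re-weighting of (L): the exit mechanism is the class, not the order, and the shapes are disjoint
((L) has a pure `εW^k` of weight `nk`; in (L′) a pure `W^{b′}` needs weight `b′(n−a) ≥ nb+1`).  For `a = 0` the count
`(k − 1)/n` is rev 3's `⌊k/n⌋` (`mixed_depth_zero_eq`).  [cite: Hironaka1964 Ch. III §3 (directrix, τ);
CossartJannsenSaito2020 Ch. 2; CossartPiltant2008 Prop. 4.2; folklore (quasi-homogeneous blow-up bookkeeping)] -/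

/-- **MIXED WEIGHT STEP** [rev 4; KERNEL (PROVED)]: a monomial `z^e U^a′ W^b′` of two-weight
`(e + a′)·b + b′·(n − a) ≥ nb + 1` (`a < n`, `a + b ≥ n + 1`) has degree `≥ n + 1`, and its `W`-chart transform
`X₀^e X₁^a′ W^(e+a′+b′−n)` has two-weight `≥ n(a + b − n) + 1` for the new exponent `a + b − n`: the two-weight ideal
REPRODUCES along the mixed ladder. [folklore] -/
theorem mixed_weight_step {n a b e a' b' : ℕ} (ha : a < n) (hab : n + 1 ≤ a + b)
    (hw : n * b + 1 ≤ (e + a') * b + b' * (n - a)) :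
    n + 1 ≤ e + a' + b' ∧
      n * (a + b - n) + 1 ≤ (e + a') * (a + b - n) + (e + a' + b' - n) * (n - a) := by
  obtain ⟨d, rfl⟩ := Nat.exists_eq_add_of_le (Nat.succ_le_of_lt ha)
  have hd : a + 1 + d - a = d + 1 := by omega
  rw [hd] at hw ⊢
  obtain ⟨g, rfl⟩ := Nat.exists_eq_add_of_le (show d + 2 ≤ b by omega)
  have h1 : a + 1 + d + 1 ≤ e + a' + b' := by
    by_contra hlt
    have hle : e + a' + b' ≤ a + 1 + d := by omega
    have : (e + a') * (d + 2 + g) + b' * (d + 1) ≤ (a + 1 + d) * (d + 2 + g) := by nlinarith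
    nlinarith
  refine ⟨h1, ?_⟩
  obtain ⟨m, hm⟩ := Nat.exists_eq_add_of_le (show a + 1 + d ≤ e + a' + b' by omega)
  have hs1 : a + (d + 2 + g) - (a + 1 + d) = g + 1 := by omega
  have hs2 : e + a' + b' - (a + 1 + d) = m := by omega
  rw [hs1, hs2]
  nlinarith [hm]

/-- **MIXED DEPTH** [rev 4; KERNEL (PROVED)]: with `bᵢ = b − i·(n − a)`, (i) the PERFORMED stages `i < (b−1)/(n−a)`
have `a + bᵢ ≥ n + 1` (near point of class 1, blow up again); at the STOP stage `i₀ = (b−1)/(n−a)`: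
(ii) `a + b_{i₀} ≤ n` and (iii) `1 ≤ b_{i₀}` (the fibre variable `W` is still present: class exit). [folklore] -/
theorem mixed_depth {n a b : ℕ} (ha : a < n) (hab : n + 1 ≤ a + b) :
    (∀ i, i < (b - 1) / (n - a) → n + 1 ≤ a + (b - i * (n - a))) ∧
      a + (b - (b - 1) / (n - a) * (n - a)) ≤ n ∧ 1 ≤ b - (b - 1) / (n - a) * (n - a) := by
  obtain ⟨d, rfl⟩ := Nat.exists_eq_add_of_le (Nat.succ_le_of_lt ha)
  have hd : a + 1 + d - a = d + 1 := by omega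
  rw [hd]
  have hdiv := Nat.div_mul_le_self (b - 1) (d + 1)
  have hmod := Nat.div_add_mod (b - 1) (d + 1)
  have hlt := Nat.mod_lt (b - 1) (show 0 < d + 1 by omega)
  refine ⟨?_, ?_, ?_⟩
  · intro i hi
    have h1 : (i + 1) * (d + 1) ≤ b - 1 := by
      have h2 : (i + 1) * (d + 1) ≤ (b - 1) / (d + 1) * (d + 1) := Nat.mul_le_mul_right _ hi
      omega
    have : (i + 1) * (d + 1) = i * (d + 1) + (d + 1) := by ring
    omega
  · have : (b - 1) / (d + 1) * (d + 1) = (d + 1) * ((b - 1) / (d + 1)) := by ring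
    omega
  · omega

/-- For `a = 0` the mixed count `(k − 1)/n` IS rev 3's ladder depth `⌊k/n⌋` (`n ∤ k`): (L′) continues (L).  KERNEL
(PROVED). [folklore] -/
theorem mixed_depth_zero_eq {n k : ℕ} (hn : 1 ≤ n) (hndvd : ¬ n ∣ k) : (k - 1) / n = k / n := by
  have hr : 0 < k % n := Nat.pos_of_ne_zero (fun h0 => hndvd (Nat.dvd_of_mod_eq_zero h0))
  have hk := Nat.div_add_mod k n
  have h1 : k - 1 = (k % n - 1) + n * (k / n) := by omega
  rw [h1, Nat.add_mul_div_left _ _ (by omega : 0 < n), Nat.div_eq_of_lt (by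
    have := Nat.mod_lt k (show 0 < n by omega); omega)]
  simp

/-- **`W`-CHART IDENTITY** for the mixed trinomial [rev 4; KERNEL (PROVED), any commutative ring]: `z = W·X₀`,
`U = W·X₁` factor `Wⁿ` off `zⁿ + βUⁿ + ε·U^aW^b`, leaving the SAME shape with `b ↦ a + b − n`. [folklore] -/
theorem mixed_chart_identity {R : Type} [CommRing R] (β ε W X₀ X₁ : R) {n a b : ℕ} (hab : n ≤ a + b) :
    (W * X₀) ^ n + β * (W * X₁) ^ n + ε * ((W * X₁) ^ a * W ^ b) =
      W ^ n * (X₀ ^ n + β * X₁ ^ n + ε * (X₁ ^ a * W ^ (a + b - n))) := by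
  obtain ⟨m, hm⟩ := Nat.exists_eq_add_of_le hab
  have h1 : a + b - n = m := by omega
  rw [h1, mul_pow, mul_pow, mul_pow]
  have key : W ^ a * W ^ b = W ^ n * W ^ m := by rw [← pow_add, ← pow_add, hm]
  calc W ^ n * X₀ ^ n + β * (W ^ n * X₁ ^ n) + ε * (W ^ a * X₁ ^ a * W ^ b)
      = W ^ n * X₀ ^ n + β * (W ^ n * X₁ ^ n) + ε * ((W ^ a * W ^ b) * X₁ ^ a) := by ring
    _ = W ^ n * X₀ ^ n + β * (W ^ n * X₁ ^ n) + ε * ((W ^ n * W ^ m) * X₁ ^ a) := by rw [key]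
    _ = W ^ n * (X₀ ^ n + β * X₁ ^ n + ε * (X₁ ^ a * W ^ m)) := by ring

/-- **SIDE-CHART IDENTITY** for the mixed trinomial [rev 4; KERNEL (PROVED)]: `U = z·U′`, `W = z·W′` factor `zⁿ` off,
leaving `1 + βU′ⁿ + ε·z^(a+b−n)·U′^aW′^b` — at a PERFORMED stage (`a + b ≥ n + 1`) the mixed term lies in the
exceptional ideal `(z)`, so the side chart is rev 3's `1 + βU′ⁿ (mod z)`: `SideClean`. [folklore] -/
theorem mixed_sidechart_identity {R : Type} [CommRing R] (β ε X₀ U' W' : R) {n a b : ℕ} (hab : n ≤ a + b) :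
    X₀ ^ n + β * (X₀ * U') ^ n + ε * ((X₀ * U') ^ a * (X₀ * W') ^ b) =
      X₀ ^ n * (1 + β * U' ^ n + ε * (X₀ ^ (a + b - n) * (U' ^ a * W' ^ b))) := by
  obtain ⟨m, hm⟩ := Nat.exists_eq_add_of_le hab
  have h1 : a + b - n = m := by omega
  rw [h1, mul_pow, mul_pow, mul_pow]
  have key : X₀ ^ a * X₀ ^ b = X₀ ^ n * X₀ ^ m := by rw [← pow_add, ← pow_add, hm]
  calc X₀ ^ n + β * (X₀ ^ n * U' ^ n) + ε * (X₀ ^ a * U' ^ a * (X₀ ^ b * W' ^ b))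
      = X₀ ^ n + β * (X₀ ^ n * U' ^ n) + ε * ((X₀ ^ a * X₀ ^ b) * (U' ^ a * W' ^ b)) := by ring
    _ = X₀ ^ n + β * (X₀ ^ n * U' ^ n) + ε * ((X₀ ^ n * X₀ ^ m) * (U' ^ a * W' ^ b)) := by rw [key]
    _ = X₀ ^ n * (1 + β * U' ^ n + ε * (X₀ ^ m * (U' ^ a * W' ^ b))) := by ring

-- bed `u₁⁵ + u₂⁵` under `v(u₁+u₂)²` (n = 2; main tail U·W⁴: a = 1, b = 4): depth (b−1)/(n−a) = 3, stop exponent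
-- b₃ = 1 with a + b₃ = 2 = n (class exit); the other tail monomials U⁵, U⁴W have two-weights 20, 17 ≥ nb+1 = 9,
-- the mixed monomial itself has weight 8 < 9 (it is NOT in the weight ideal).

example : (4 - 1) / (2 - 1) = 3 ∧ 1 + (4 - 3 * (2 - 1)) = 2 ∧ 1 ≤ 4 - 3 * (2 - 1) ∧
    2 * 4 + 1 ≤ (0 + 5) * 4 + 0 * (2 - 1) ∧ 2 * 4 + 1 ≤ (0 + 4) * 4 + 1 * (2 - 1) ∧
    ¬ (2 * 4 + 1 ≤ (0 + 1) * 4 + 4 * (2 - 1)) := by decide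

example : (7 - 1) / 2 = 7 / 2 ∧ (7 - 1) / 3 = 7 / 3 := by decide   -- deeptail:2/3 read with a = 0: same depth as rev 3

end MixedKernel

section MixedField

variable {K : Type} [Field K] {m : ℕ}

/-- **FIBRE-MONOMIAL LEMMA** [rev 4; KERNEL (PROVED) — the class exit of the mixed ladder].  Over any field: a
polynomial that INVOLVES the variable `X_{i₂}` (`P ∉ K[X_i : i ≠ i₂]`) but VANISHES at the `i₂`-th coordinate point is
NOT a scalar multiple of a power of a linear form (`P ≠ c·ℓⁿ` for all `c`, `ℓ`, `n`: evaluating at `e_{i₂}` gives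
`c·ℓ(e_{i₂})ⁿ = 0`, so `c = 0` or `ℓ` omits `X_{i₂}` — either way `P` would omit `X_{i₂}`).  Read on the stop stage of
the mixed ladder (`K = k(x′)`, the graded ring of `𝒪_{x′}`, `X_{i₂} = W̄`): the initial form
`X̄₀ⁿ [+ β̄X̄₁ⁿ] + ε̄X̄₁^aW̄^b + Q̄` involves `W̄` and has no `W̄ⁿ`, so it spans no line `K·ℓⁿ`: `τ(x′) ≥ 2`.  Here
`τ(x′)` is the
port's invariant = the dimension of Hironaka's DIRECTRIX of the initial form `in_{x′}(f)` over the residue field `κ(x′)`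
(equivalently, for this use, over `κ̄(x′)`: the lemma holds over ANY field `K`, so both readings are covered; `τ = 1` ⟺
`in(f) = c·ℓⁿ` for a linear form `ℓ`; HYGIENE h8).
[folklore; Hironaka1964 Ch. III §3 (directrix); CossartJannsenSaito2020 Ch. 2] [folklore] -/
theorem not_purePower_of_fibre (i₂ : Fin m) {P : MvPolynomial (Fin m) K}
    (hW : P ∉ MvPolynomial.supported K ({i₂}ᶜ : Set (Fin m)))
    (h0 : MvPolynomial.eval (fun i => if i = i₂ then (1 : K) else 0) P = 0) :
    ¬ ∃ (c : K) (l : Fin m → K) (n : ℕ),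
      P = MvPolynomial.C c * (∑ i, MvPolynomial.C (l i) * MvPolynomial.X i) ^ n := by
  rintro ⟨c, l, n, hP⟩
  have hCmem : ∀ r : K, (MvPolynomial.C r : MvPolynomial (Fin m) K) ∈
      MvPolynomial.supported K ({i₂}ᶜ : Set (Fin m)) := by
    intro r
    have h := Subalgebra.algebraMap_mem (MvPolynomial.supported K ({i₂}ᶜ : Set (Fin m))) r
    rwa [MvPolynomial.algebraMap_eq] at h
  have hev : c * l i₂ ^ n = 0 := by
    have h := h0
    rw [hP, map_mul, MvPolynomial.eval_C, map_pow, eval_indicator_linearForm] at h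
    exact h
  rcases mul_eq_zero.mp hev with hc | hl
  · apply hW
    rw [hP, hc, map_zero, zero_mul]
    exact Subalgebra.zero_mem _
  · have hl2 : l i₂ = 0 := (pow_eq_zero_iff'.mp hl).1
    apply hW
    have hℓ : (∑ i, MvPolynomial.C (l i) * MvPolynomial.X i : MvPolynomial (Fin m) K) ∈
        MvPolynomial.supported K ({i₂}ᶜ : Set (Fin m)) := by
      refine Subalgebra.sum_mem _ fun i _ => ?_
      by_cases hi : i = i₂
      · subst hi; simp [hl2]
      · exact Subalgebra.mul_mem _ (hCmem (l i)) (MvPolynomial.mem_supported.2 (by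
          simpa [MvPolynomial.vars_X] using (Ne.symm hi)))
    rw [hP]
    exact Subalgebra.mul_mem _ (hCmem c) (Subalgebra.pow_mem _ hℓ n)

/-- Bed instance of the class exit (`u₁⁵ + u₂⁵` under `v(u₁+u₂)²`, characteristic 2, stop stage 3: initial form
`X̄₀² + X̄₁·W̄`; variables `X₀ ↦ 0, X₁ ↦ 1, W ↦ 2, v ↦ 3`): it involves `W̄` and vanishes at the `W̄`-point, so it is
no `c·ℓⁿ` — the depth-3 near point has `τ ≥ 2` (census T-tame :824: `X₀² + u_j·w`, `τ = 3`).  KERNEL (PROVED). -/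
example : ¬ ∃ (c : ZMod 2) (l : Fin 4 → ZMod 2) (n : ℕ),
    (MvPolynomial.X 0 ^ 2 + MvPolynomial.X 1 * MvPolynomial.X 2 : MvPolynomial (Fin 4) (ZMod 2)) =
      MvPolynomial.C c * (∑ i, MvPolynomial.C (l i) * MvPolynomial.X i) ^ n := by
  haveI : Fact (Nat.Prime 2) := ⟨by norm_num⟩
  refine not_purePower_of_fibre 2 ?_ (by simp [MvPolynomial.eval_X])
  intro h
  have hv := MvPolynomial.mem_supported.1 h
  have key := MvPolynomial.eval₂Hom_congr' (f₁ := RingHom.id (ZMod 2)) (f₂ := RingHom.id (ZMod 2))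
      (g₁ := fun i : Fin 4 => if i = 1 ∨ i = 2 then (1 : ZMod 2) else 0)
      (g₂ := fun i : Fin 4 => if i = 1 then (1 : ZMod 2) else 0)
      (p₁ := (MvPolynomial.X 0 ^ 2 + MvPolynomial.X 1 * MvPolynomial.X 2 : MvPolynomial (Fin 4) (ZMod 2)))
      rfl ?_ rfl
  · simp at key
  · intro i hi _
    have hi' : i ∈ (({2}ᶜ : Set (Fin 4))) := hv hi
    fin_cases i <;> simp at hi' ⊢

end MixedField

section MixedRing

variable {R : Type} [CommRing R]

/-- **TWO-WEIGHT IDEAL** `WtIdeal₂ c wU wW N` [rev 4]: the ideal spanned by the monomials `c 0 ^ e * c 1 ^ a′ * c 2 ^ b′`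
with `(e + a′)·wU + b′·wW ≥ N` (`c = (z, U, W)`; weights `wU, wU, wW`).  DEFINITION (NEW object, generalising rev 3's
`WtIdeal`). [folklore] -/
def WtIdeal₂ (c : Fin 3 → R) (wU wW N : ℕ) : Ideal R :=
  Ideal.span {x : R | ∃ e a' b' : ℕ, N ≤ (e + a') * wU + b' * wW ∧ x = c 0 ^ e * c 1 ^ a' * c 2 ^ b'}

/-- rev 3's weight ideal IS the two-weight ideal with weights `(k, k, n)` — definitionally.  KERNEL (PROVED). [folklore] -/
theorem wtIdeal_eq_wtIdeal₂ (c : Fin 3 → R) (n k N : ℕ) : WtIdeal c n k N = WtIdeal₂ c k n N := rfl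

/-- **MIXED LADDER SHAPE** `MixedLadderShape M c β ε h f n a b` [rev 4; the one-step-reproducing presentation]:
`f = c 0 ^ n + β * c 1 ^ n + ε * (c 1 ^ a * c 2 ^ b) + h`, `ε` a unit, `h ∈ WtIdeal₂ c b (n − a) (n*b + 1)`,
`1 ≤ a < n`, `n + 1 ≤ a + b`, the cone coefficient `β` a transversal parameter (`span (c, β) = M`) or a unit, and rev 3's
side condition.  EXACT-ON-PAPER consequence (§M docstring): principal `I = (f)` of mixed ladder shape uniformly along
the regular top curve `V(c)` exits — by CLASS ≥ 2 or order drop — after `(b − 1)/(n − a)` blow-ups of section curves.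
DEFINITION (NEW class predicate). [folklore; CossartJannsenSaito2020 Ch. 2] -/
def MixedLadderShape (M : Ideal R) (c : Fin 3 → R) (β ε h f : R) (n a b : ℕ) : Prop :=
  f = c 0 ^ n + β * c 1 ^ n + ε * (c 1 ^ a * c 2 ^ b) + h ∧ IsUnit ε ∧ h ∈ WtIdeal₂ c b (n - a) (n * b + 1) ∧
    1 ≤ a ∧ a < n ∧ n + 1 ≤ a + b ∧ (Ideal.span (Set.range c ∪ {β}) = M ∨ IsUnit β) ∧ SideClean M c β n

/-- The model mixed trinomial itself (`h = 0`) has mixed ladder shape whenever the exponents and side data are right.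
KERNEL (PROVED). [folklore] -/
theorem mixedLadderShape_trinomial (M : Ideal R) (c : Fin 3 → R) (β ε : R) (n a b : ℕ) (hε : IsUnit ε)
    (ha1 : 1 ≤ a) (ha : a < n) (hab : n + 1 ≤ a + b) (hβ : Ideal.span (Set.range c ∪ {β}) = M ∨ IsUnit β)
    (hside : SideClean M c β n) :
    MixedLadderShape M c β ε 0 (c 0 ^ n + β * c 1 ^ n + ε * (c 1 ^ a * c 2 ^ b)) n a b :=
  ⟨by rw [add_zero], hε, Ideal.zero_mem _, ha1, ha, hab, hβ, hside⟩

/-- A tail monomial of large enough two-weight may be added without leaving the class (e.g. `U⁵`, `U⁴W` of the bed):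
membership of a single monomial in `WtIdeal₂`.  KERNEL (PROVED). [folklore] -/
theorem monomial_mem_wtIdeal₂ (c : Fin 3 → R) (wU wW N e a' b' : ℕ) (h : N ≤ (e + a') * wU + b' * wW) :
    c 0 ^ e * c 1 ^ a' * c 2 ^ b' ∈ WtIdeal₂ c wU wW N :=
  Ideal.subset_span ⟨e, a', b', h, rfl⟩

/-- Bed: the two higher tail monomials `U⁵ = c 1 ^ 5` and `U⁴W = c 1 ^ 4 * c 2` of `u₁⁵ + u₂⁵` lie in
`WtIdeal₂ c 4 1 9` (`n = 2`, `a = 1`, `b = 4`), so `h = U⁵ + U⁴W` is admissible.  KERNEL (PROVED). -/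
example (c : Fin 3 → R) : c 1 ^ 5 + c 1 ^ 4 * c 2 ∈ WtIdeal₂ c 4 1 9 := by
  refine Ideal.add_mem _ ?_ ?_
  · simpa using monomial_mem_wtIdeal₂ c 4 1 9 0 5 0 (by decide)
  · simpa using monomial_mem_wtIdeal₂ c 4 1 9 0 4 1 (by decide)

end MixedRing

/-! ### §M2  point level — mixed ladder points, uniformly shaped curves, ENGINE (L′), the BROAD leaf and its residual -/

/-- **MIXED-LADDER-SHAPED at `y` transversal to `η` with exponents `(n, a, b)`** [rev 4] (`IsMixedLadderAt I n a b η y`):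
germ dimension 4, regular parameters `c = (z, U, W)` generating the curve prime, `(c, v) = 𝔪_y`, `I_y = (f)` PRINCIPAL,
`f` of mixed ladder shape.  DEFINITION (NEW class predicate). (Sources: CossartJannsenSaito2020 Ch. 2; folklore.) -/
def IsMixedLadderAt {Y : Scheme.{0}} (I : Y.IdealSheafData) (n a b : ℕ) (η y : Y) : Prop :=
  ∃ h : η ⤳ y, ∃ (c : Fin 3 → Y.presheaf.stalk y) (v β ε r f : Y.presheaf.stalk y),
    Ideal.span (Set.range c) = curvePrime h ∧
      Ideal.span (Set.range c ∪ {v}) = maximalIdeal (Y.presheaf.stalk y) ∧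
      (maximalIdeal (Y.presheaf.stalk y)).spanFinrank = 4 ∧
      stalkIdeal I y = Ideal.span {f} ∧
      MixedLadderShape (maximalIdeal (Y.presheaf.stalk y)) c β ε r f n a b

/-- **UNIFORMLY MIXED-LADDER-SHAPED CURVE** [rev 4] (`IsUniformMixedLadderCurve I n a b η`): `η` is a curve point and
EVERY closed point of `closure {η}` is mixed-ladder-shaped transversal to `η` with the SAME exponents `(n, a, b)`.  The
hypothesis of ENGINE (L′).  DEFINITION (NEW class predicate). -/
def IsUniformMixedLadderCurve {Y : Scheme.{0}} (I : Y.IdealSheafData) (n a b : ℕ) (η : Y) : Prop :=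
  IsCurvePt η ∧ ∀ y : Y, η ⤳ y → IsClosed ({y} : Set Y) → IsMixedLadderAt I n a b η y

/-- **ENGINE (L′) `MixedLadderExit`** [rev 4; DECIDED · paper proof = the mixed ladder of the §M docstring:
`(b − 1)/(n − a)` blow-ups of section curves, shape reproduction by `mixed_chart_identity` / `mixed_weight_step`
(KERNEL), side charts by `mixed_sidechart_identity` (KERNEL) + `SideClean`, stop stage by `mixed_depth` (KERNEL), CLASS
EXIT by `not_purePower_of_fibre` (KERNEL) or order drop; ingredients of the port: HS 5.5.5 regularity of the chart
rings, permissibility of regular centres in the top locus of a principal marked ideal, semicontinuity of order — the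
whole argument is commutative algebra over the regular local rings `𝒪_{Y,y′}` (`y′` closed on `closure {η}`) and over
`𝒪_{Y,η}`; no generic-point theorem · every regular scheme, residue field, characteristic]: a uniformly
mixed-ladder-shaped curve of order `n ≥ 2` has an exit package with centres over it.  STATEMENT (engine). (Sources:
Hironaka1964; CossartJannsenSaito2020 Ch. 2, Ch. 8; CossartPiltant2008 Prop. 4.2.) -/
def MixedLadderExit : Prop :=
  ∀ (Y : Scheme.{0}), Scheme.IsRegular Y → ∀ (I : Y.IdealSheafData) (n : ℕ), 2 ≤ n → ∀ (a b : ℕ) (η : Y),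
    IsUniformMixedLadderCurve I n a b η → PackageExitsOver I n {y : Y | η ⤳ y}

/-- **MIXED-LADDER-CURVE point** [rev 4] (NEW DECIDED CLASS, leaf (L′)): `y` lies on (or is the generic point of) a
Top-isolated, uniformly mixed-ladder-shaped curve.  DEFINITION (NEW class). -/
def IsMixedLadderCurvePt {Y : Scheme.{0}} (I : Y.IdealSheafData) (n : ℕ) (y : Y) : Prop :=
  ∃ (η : Y) (a b : ℕ), η ⤳ y ∧ IsTopIsolatedClosure I n η ∧ IsUniformMixedLadderCurve I n a b η

/-- **BROAD-CURVE point** [rev 4] (leaf (B) = (W) ∪ (L′)): wide-curve OR mixed-ladder-curve.  DEFINITION (NEW class). -/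
def IsBroadCurvePt {Y : Scheme.{0}} (I : Y.IdealSheafData) (n : ℕ) (y : Y) : Prop :=
  IsWideCurvePt I n y ∨ IsMixedLadderCurvePt I n y

/-- **ENGINE (B)** = both engines (W) and (L′).  STATEMENT (conjunction of engines). -/
def BroadExit : Prop :=
  WideExit ∧ MixedLadderExit

/-- **BROAD-SPECIAL core point** [rev 4] (THE RE-LOCATED CLASS): pinch-special and neither wide-curve nor
mixed-ladder-curve (bed: binary towers with cancelling edge forms, non-principal germs; NOT `u₁⁵ + u₂⁵`, NOT
`deeptail:2/3`, NOT `branch:2`).  DEFINITION (NEW class). [folklore] -/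
def IsBroadSpecialPt {k : Type} [Field k] {Y : Scheme.{0}} (g : Y ⟶ Spec (.of k)) (hY : Scheme.IsRegular Y)
    (I : Y.IdealSheafData) (n : ℕ) (y : Y) : Prop :=
  IsPinchSpecialPt g hY I n y ∧ ¬ IsBroadCurvePt I n y

/-- (W) ⊆ (B).  KERNEL (PROVED). [folklore] -/
theorem isBroadCurvePt_of_isWideCurvePt {Y : Scheme.{0}} {I : Y.IdealSheafData} {n : ℕ} {y : Y} :
    IsWideCurvePt I n y → IsBroadCurvePt I n y :=
  Or.inl

/-- (L′) ⊆ (B).  KERNEL (PROVED). [folklore] -/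
theorem isBroadCurvePt_of_isMixedLadderCurvePt {Y : Scheme.{0}} {I : Y.IdealSheafData} {n : ℕ} {y : Y} :
    IsMixedLadderCurvePt I n y → IsBroadCurvePt I n y :=
  Or.inr

/-- (T) ⊆ (B).  KERNEL (PROVED). [folklore] -/
theorem isBroadCurvePt_of_isJetTameCurvePt {Y : Scheme.{0}} {I : Y.IdealSheafData} {n : ℕ} {y : Y} :
    IsJetTameCurvePt I n y → IsBroadCurvePt I n y :=
  fun h => Or.inl (Or.inl h)

end Summit.ResolutionOfSingularities.ResolutionOfSingularities.Theorems.JetCut
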